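import Literature.AnabelianGeometry.EtaleTheta.TemperedFrobenioidCor38SubPreStepsBaseFS
import Literature.AnabelianGeometry.EtaleTheta.TemperedFrobenioidToyAffineDilation
import HarnessLib

/-!
# [EtTh] Cor. 3.8 proof row C38-L02a `PreservesPreSteps` (F-2809): the DEGREE half from a UNIT obstruction —
# a fiberwise-surjective morphism over a monic base arrow is LINEAR as soon as the genuine units carry a
# `d`-th-power obstruction; hence a structural closer of the row with NO [FrdI] Thm. 3.4 / F-2815 input

S. Mochizuki, *The étale theta function and its Frobenioid-theoretic manifestations*, Publ. RIMS **45** (2009)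
[EtTh], Cor. 3.8 proof, PDF p. 81 l. 2–3 ("by [Mzk17], Theorem 3.4, (ii) … it follows that `Ψ` preserves
pre-steps") [cite: MochizukiEtTh2009, Cor 3.8 p.81]; S. Mochizuki, *The geometry of Frobenioids I*, Kyushu J.
Math. **62** (2008) [FrdI], §0 p. 14 (fiberwise-surjective morphisms), Def. 1.2 (ii)–(iii) pp. 21–22 (linear
morphisms, base-isomorphisms, pre-steps), Thm. 5.2 (i) p. 100 (the model Frobenioid: `u_{ψ∘φ} = Base(φ)^* u_ψ ·
u_φ^{deg_Fr ψ}`) [cite: MochizukiFrdI2008, Thm. 5.2(i) p.100].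

abc-iut cell, block F, seat abc-iut-f-111 (gen 5).  PROOF-ONLY file (0 definitions of `Prop`s, 0 instances, 0
notation), a further HAND for the decision on the bare universal closure of `Cor38Hyp.PreservesPreSteps` (FACT-LIST
F-2809, lease abc-iut-f-032), on top of abc-iut-w6-d057's `TemperedFrobenioidCor38SubPreStepsBaseFS.lean` (for EVERY
record `h`, `Ψ` of a pre-step is FIBERWISE-SURJECTIVE and so is its `Base`).  That file closes the row from row
F-2815 at `h` (`PreservesLinear`, whose universal closure is REFUTED, abc-iut-f-133 `AffDil`) plus "fiberwise-
surjective ⇒ invertible" in the bases; abc-iut-f-109 / abc-iut-w6-d079 close it for PARTNERED pre-steps (cofinal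
principal divisors).  Here the DEGREE half is obtained WITHOUT F-2815 and WITHOUT partners, from the UNITS:

* **`ModelFrobenioid.degFr_eq_one_of_isFiberwiseSurjective_of_mono_baseMap`** (model Frobenioid of ANY data
  `(D, Φ, B, B → Φ^gp)` with `B` group-like): let `φ = (d, f, Z, u) : (A_D, α) → (A'_D, α')` be fiberwise-surjective
  with `f` a monomorphism of `D`.  If `d ≠ 1` admits a genuine unit `v ∈ B(A_D)` (`Div_B v = 0`) NONE of whose
  pull-backs `g^* v` (`g : E → A_D`) is a `d`-th power in `B(E)`, contradiction: the unit-twin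
  `φ_v := (d, f, Z, u·v)` is co-objective with `φ`, a completing square `δ_B ≫ φ = δ_X ≫ φ_v` has
  `Base δ_B = Base δ_X =: g` (`f` monic) and unit coordinates `g^*u · u_{δ_B}^d = g^*u · g^*v · u_{δ_X}^d`, i.e.
  `g^*v = (u_{δ_B} u_{δ_X}⁻¹)^d`.  So such a `φ` is LINEAR.
* **`ModelFrobenioid.unitObstruction_of_valuation`**: the obstruction holds for every `d ≥ 2` as soon as `B` carries
  a pull-back-invariant homomorphism `χ : B → ℤ` with `χ(v) = 1` on some genuine unit `v` at each object (a free
  unit line fixed by the base: abc-iut-f-133's `AffDil` / `DegreeSwap`, the `UnitToy` family, `ℤ × …`-valued `B₀^Λ`).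
* Hence for EVERY record `h : Cor38Hyp C₁ C₂` of typed tempered Frobenioids (`B = B₀^Λ|_D ×_{(Φ^{ℝ-log})^gp} Φ^gp` is
  group-like by Def. 3.6 (i)): **`Cor38Hyp.isLinear_map_of_isPreStep_of_unitObstruction`** — if `C₂` has the unit
  obstruction and `Base(Ψ φ)` is monic (automatic over thin bases, over `SingleObj` of a left-cancellative monoid, and
  whenever it is invertible), then `Ψ φ` is LINEAR for every pre-step `φ` of `C₁`, partnered or not; and the
  STRUCTURAL closer **`Cor38Hyp.preservesPreSteps_of_unitObstruction_of_isIso_of_isFiberwiseSurjective`**: unit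
  obstruction on both sides + "fiberwise-surjective ⇒ invertible" in `D₁`, `D₂` (points, groupoids,
  `SingleObj Aff⁺(ℤ)`, `SingleObj` of a free monoid) ⇒ `Ψ` preserves pre-steps — abc-iut-w6-d057's closer with its
  F-2815 hypothesis REPLACED by a property of the data.
READING (cell rule R5; FACT-LIST label of F-2809 NOT moved: conditional / instance PROVED / bare closure open):
combined with `…PreStepsBaseFS` / `…PreStepsPartners` / `…PreStepsMonoDescent`, a separating record must move a
partner-less pre-step EITHER to a linear morphism over a non-invertible FSM arrow between distinct objects of `D₂`,
OR to a morphism of degree `d ≥ 2` over a monic base arrow at an object where EVERY genuine unit of `C₂` has a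
pull-back that is a `d`-th power (e.g. divisible or trivial `Ker Div_B`), OR to a morphism over a non-monic
(fiberwise-surjective) base arrow.  No [FrdI] Thm. 3.4 input; no Frobenioid axiom; vocabulary clauses untouched.
HONEST FRAMING: bookkeeping about OUR typed Def. 3.6 interface (print's Cor. 3.8 quotes [FrdI] Thm. 3.4 (ii) for
genuine Frobenioids); nothing here bears on [IUTchIII] Cor. 3.12; no side taken; a FACT row is an assumption label;
typed ≠ proved.
-/

namespace Literature.AlgebraicGeometry.Frobenioids

open CategoryTheory Opposite

universe w v u

namespace ModelFrobenioid

variable {D : Type u} [Category.{v} D] {Φ B : Dᵒᵖ ⥤ CommMonCat.{w}} {DivB : B ⟶ monoidGp Φ}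

/-- **A fiberwise-surjective morphism over a monic base arrow is linear, given a unit obstruction in its degree**
([FrdI] Thm. 5.2 (i) composition law for `u_φ`; §0 p. 14).  `B` group-like; `hK`: for the degree `d = deg_Fr(φ)`,
if `d ≠ 1` there is `v ∈ B(A_D)` with `Div_B v = 0` none of whose pull-backs is a `d`-th power.
[cite: MochizukiFrdI2008, Thm. 5.2(i) p.100] -/
theorem degFr_eq_one_of_isFiberwiseSurjective_of_mono_baseMap
    (hB : ∀ (A : Dᵒᵖ) (b : (B.obj A : Type w)), IsUnit b)
    {X Y : ModelFrobenioid Φ B DivB} (φ : X ⟶ Y) [Mono (baseMap φ)]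
    (hK : degFr φ ≠ 1 → ∃ v : (B.obj (op X.base) : Type w), divB Φ B DivB (op X.base) v = 1 ∧
      ∀ ⦃E : D⦄ (g : E ⟶ X.base) (t : (B.obj (op E) : Type w)), (B.map g.op).hom v ≠ t ^ (degFr φ : ℕ))
    (hφ : IsFiberwiseSurjective φ) : degFr φ = 1 := by
  by_contra hd
  obtain ⟨v, hv, hnot⟩ := hK hd
  -- the unit-twin `φ_v = (d, f, Z, u·v)`, co-objective with `φ`
  let φv : X ⟶ Y :=
    { degFr := degFr φ
      base := baseMap φ
      div := div φ
      unit := unit φ * v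
      rel := by rw [map_mul, hv, mul_one]; exact rel φ }
  obtain ⟨W, δB, δX, hsq⟩ := hφ φv
  have hbase : baseMap δB = baseMap δX := by
    have hb : baseMap δB ≫ baseMap φ = baseMap δX ≫ baseMap φ := congrArg Hom.base hsq
    exact (cancel_mono _).mp hb
  have hu : (B.map (baseMap δB).op).hom (unit φ) * unit δB ^ (degFr φ : ℕ) =
      (B.map (baseMap δX).op).hom (unit φ * v) * unit δX ^ (degFr φ : ℕ) := congrArg Hom.unit hsq
  rw [hbase, map_mul] at hu
  have hu' : unit δB ^ (degFr φ : ℕ) = (B.map (baseMap δX).op).hom v * unit δX ^ (degFr φ : ℕ) :=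
    (hB _ _).mul_left_cancel (hu.trans (mul_assoc _ _ _))
  obtain ⟨U, hU⟩ := hB _ (unit δX)
  refine hnot (baseMap δX) (unit δB * ↑U⁻¹) ?_
  rw [mul_pow, hu', ← hU, mul_assoc, ← mul_pow, Units.mul_inv, one_pow, mul_one]

/-- **The unit obstruction from a valuation**: if `B` carries homomorphisms `χ_A : B(A) → ℤ` compatible with all
pull-backs and `v ∈ B(A_D)` is a genuine unit (`Div_B v = 0`) with `χ(v) = 1`, then no pull-back of `v` is a `d`-th
power for `d ≥ 2`. [cite: MochizukiFrdI2008, Thm. 5.2(i) p.100] -/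
theorem unitObstruction_of_valuation (χ : ∀ A : Dᵒᵖ, (B.obj A : Type w) →* Multiplicative ℤ)
    (hχ : ∀ ⦃A A' : Dᵒᵖ⦄ (f : A ⟶ A') (b : (B.obj A : Type w)), χ A' ((B.map f).hom b) = χ A b)
    {A : D} (v : (B.obj (op A) : Type w)) (hχv : χ (op A) v = Multiplicative.ofAdd 1)
    {d : ℕ+} (hd : d ≠ 1) ⦃E : D⦄ (g : E ⟶ A) (t : (B.obj (op E) : Type w)) :
    (B.map g.op).hom v ≠ t ^ (d : ℕ) := by
  intro h
  have h1 := congrArg (χ (op E)) h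
  rw [hχ, hχv, map_pow] at h1
  have h2 : (1 : ℤ) = (d : ℕ) * Multiplicative.toAdd (χ (op E) t) := by
    have := congrArg Multiplicative.toAdd h1
    rwa [toAdd_ofAdd, toAdd_pow, nsmul_eq_mul] at this
  have h3 : ((d : ℕ) : ℤ) = 1 :=
    Int.eq_one_of_mul_eq_one_right (Int.natCast_nonneg _) h2.symm
  exact hd (PNat.coe_eq_one_iff.mp (by exact_mod_cast h3))

end ModelFrobenioid

end Literature.AlgebraicGeometry.Frobenioids

/-! ## The row C38-L02a over the typed Def. 3.6 interface -/

namespace Literature.AnabelianGeometry.EtaleTheta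

open CategoryTheory Opposite Literature.AlgebraicGeometry.Frobenioids

universe u₀ v₀ u v w

variable {D₀ : Type u₀} [Category.{v₀} D₀] {V : FrdIMonoidStub.{w}}
  {T : RealifiedDivisorMonoids (D₀ := D₀) V} {D : Type u} [Category.{v} D] {VD : FrdICatStub.{u, v, w} D}

section Rows

variable {D₀' : Type u₀} [Category.{v₀} D₀'] {T' : RealifiedDivisorMonoids (D₀ := D₀') V}
  {D' : Type u} [Category.{v} D'] {VD' : FrdICatStub.{u, v, w} D'}
  {C₁ : TemperedFrobenioid T D VD} {C₂ : TemperedFrobenioid T' D' VD'}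

namespace Cor38Hyp

variable (h : Cor38Hyp C₁ C₂)

/-- **Row C38-L02a / F-2809, DEGREE HALF from a unit obstruction**: if at every object of `D₂` and for every
`d ≥ 2` the rational-function monoid `B` of `C₂` has a genuine unit none of whose pull-backs is a `d`-th power, then
for every pre-step `φ` of `C₁` whose image has MONIC base, `Ψ φ` is linear — for EVERY record `h`, with no
hypothesis on `C₁` and no partner. [cite: MochizukiEtTh2009, Cor 3.8 p.81] -/
theorem isLinear_map_of_isPreStep_of_unitObstruction
    (hK : ∀ (A : D') (d : ℕ+), d ≠ 1 → ∃ v : (C₂.ratFnFunctor.obj (op A) : Type w),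
      divB C₂.divisorMonoid C₂.ratFnFunctor C₂.divBNatTrans (op A) v = 1 ∧
      ∀ ⦃E : D'⦄ (g : E ⟶ A) (t : (C₂.ratFnFunctor.obj (op E) : Type w)),
        (C₂.ratFnFunctor.map g.op).hom v ≠ t ^ (d : ℕ))
    {X Y : C₁.category} (φ : X ⟶ Y) (hφ : C₁.opsData.IsPreStep φ)
    [Mono (ModelFrobenioid.baseMap (h.Ψ.functor.map φ))] :
    C₂.opsData.IsLinear (h.Ψ.functor.map φ) :=
  ModelFrobenioid.degFr_eq_one_of_isFiberwiseSurjective_of_mono_baseMap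
    (fun _ b => C₂.isUnit_ratFn (T'.isUnit_BΛ _) b) (h.Ψ.functor.map φ) (hK _ _)
    (h.isFiberwiseSurjective_map_of_isPreStep φ hφ)

/-- The mirror for `Ψ⁻¹`: unit obstruction in `C₁` and monic `Base(Ψ⁻¹ φ)` ⇒ `Ψ⁻¹ φ` linear for every pre-step
`φ` of `C₂`. [cite: MochizukiEtTh2009, Cor 3.8 p.81] -/
theorem isLinear_inverse_map_of_isPreStep_of_unitObstruction
    (hK : ∀ (A : D) (d : ℕ+), d ≠ 1 → ∃ v : (C₁.ratFnFunctor.obj (op A) : Type w),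
      divB C₁.divisorMonoid C₁.ratFnFunctor C₁.divBNatTrans (op A) v = 1 ∧
      ∀ ⦃E : D⦄ (g : E ⟶ A) (t : (C₁.ratFnFunctor.obj (op E) : Type w)),
        (C₁.ratFnFunctor.map g.op).hom v ≠ t ^ (d : ℕ))
    {X Y : C₂.category} (φ : X ⟶ Y) (hφ : C₂.opsData.IsPreStep φ)
    [Mono (ModelFrobenioid.baseMap (h.Ψ.inverse.map φ))] :
    C₁.opsData.IsLinear (h.Ψ.inverse.map φ) :=
  ModelFrobenioid.degFr_eq_one_of_isFiberwiseSurjective_of_mono_baseMap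
    (fun _ b => C₁.isUnit_ratFn (T.isUnit_BΛ _) b) (h.Ψ.inverse.map φ) (hK _ _)
    (IsFiberwiseSurjective.map_equivalence h.Ψ.symm (C₂.isFiberwiseSurjective_of_isPreStep φ hφ))

/-- **Row C38-L02a / F-2809 over monic bases, degree half**: if every arrow of `D₂` is a monomorphism (thin
bases, `SingleObj` of a left-cancellative monoid, …) and `C₂` has the unit obstruction, `Ψ` of every pre-step is
linear. [cite: MochizukiEtTh2009, Cor 3.8 p.81] -/
theorem isLinear_map_of_isPreStep_of_unitObstruction_of_mono
    (hm' : ∀ ⦃a b : D'⦄ (g : a ⟶ b), Mono g)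
    (hK : ∀ (A : D') (d : ℕ+), d ≠ 1 → ∃ v : (C₂.ratFnFunctor.obj (op A) : Type w),
      divB C₂.divisorMonoid C₂.ratFnFunctor C₂.divBNatTrans (op A) v = 1 ∧
      ∀ ⦃E : D'⦄ (g : E ⟶ A) (t : (C₂.ratFnFunctor.obj (op E) : Type w)),
        (C₂.ratFnFunctor.map g.op).hom v ≠ t ^ (d : ℕ))
    {X Y : C₁.category} (φ : X ⟶ Y) (hφ : C₁.opsData.IsPreStep φ) :
    C₂.opsData.IsLinear (h.Ψ.functor.map φ) := by
  haveI := hm' (ModelFrobenioid.baseMap (h.Ψ.functor.map φ))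
  exact h.isLinear_map_of_isPreStep_of_unitObstruction hK φ hφ

/-- **Row C38-L02a / F-2809, one direction, STRUCTURAL**: "fiberwise-surjective ⇒ invertible" in `D₂` and the unit
obstruction in `C₂` ⇒ `Ψ` carries every pre-step of `C₁` to a pre-step of `C₂` (no hypothesis on `C₁`, no partner,
no F-2815). [cite: MochizukiEtTh2009, Cor 3.8 p.81] -/
theorem isPreStep_map_of_isPreStep_of_unitObstruction
    (hD' : ∀ ⦃a b : D'⦄ (g : a ⟶ b), IsFiberwiseSurjective g → IsIso g)
    (hK : ∀ (A : D') (d : ℕ+), d ≠ 1 → ∃ v : (C₂.ratFnFunctor.obj (op A) : Type w),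
      divB C₂.divisorMonoid C₂.ratFnFunctor C₂.divBNatTrans (op A) v = 1 ∧
      ∀ ⦃E : D'⦄ (g : E ⟶ A) (t : (C₂.ratFnFunctor.obj (op E) : Type w)),
        (C₂.ratFnFunctor.map g.op).hom v ≠ t ^ (d : ℕ))
    {X Y : C₁.category} (φ : X ⟶ Y) (hφ : C₁.opsData.IsPreStep φ) :
    C₂.opsData.IsPreStep (h.Ψ.functor.map φ) := by
  have hb : IsIso (ModelFrobenioid.baseMap (h.Ψ.functor.map φ)) :=
    hD' _ (h.isFiberwiseSurjective_baseMap_map_of_isPreStep φ hφ)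
  exact ⟨h.isLinear_map_of_isPreStep_of_unitObstruction hK φ hφ, hb⟩

/-- The mirror for `Ψ⁻¹`. [cite: MochizukiEtTh2009, Cor 3.8 p.81] -/
theorem isPreStep_inverse_map_of_isPreStep_of_unitObstruction
    (hD : ∀ ⦃a b : D⦄ (g : a ⟶ b), IsFiberwiseSurjective g → IsIso g)
    (hK : ∀ (A : D) (d : ℕ+), d ≠ 1 → ∃ v : (C₁.ratFnFunctor.obj (op A) : Type w),
      divB C₁.divisorMonoid C₁.ratFnFunctor C₁.divBNatTrans (op A) v = 1 ∧
      ∀ ⦃E : D⦄ (g : E ⟶ A) (t : (C₁.ratFnFunctor.obj (op E) : Type w)),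
        (C₁.ratFnFunctor.map g.op).hom v ≠ t ^ (d : ℕ))
    {X Y : C₂.category} (φ : X ⟶ Y) (hφ : C₂.opsData.IsPreStep φ) :
    C₁.opsData.IsPreStep (h.Ψ.inverse.map φ) := by
  have hb : IsIso (ModelFrobenioid.baseMap (h.Ψ.inverse.map φ)) :=
    hD _ (h.isFiberwiseSurjective_baseMap_inverse_map_of_isPreStep φ hφ)
  exact ⟨h.isLinear_inverse_map_of_isPreStep_of_unitObstruction hK φ hφ, hb⟩

/-- **Structural closer of row C38-L02a (F-2809)**: unit obstruction in `C₁`, `C₂` and "fiberwise-surjective ⇒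
invertible" in `D₁`, `D₂` ⇒ `Ψ` preserves pre-steps (abc-iut-w6-d057's closer with the F-2815 hypothesis replaced
by a property of the data). [cite: MochizukiEtTh2009, Cor 3.8 p.81] -/
theorem preservesPreSteps_of_unitObstruction_of_isIso_of_isFiberwiseSurjective
    (hD : ∀ ⦃a b : D⦄ (g : a ⟶ b), IsFiberwiseSurjective g → IsIso g)
    (hD' : ∀ ⦃a b : D'⦄ (g : a ⟶ b), IsFiberwiseSurjective g → IsIso g)
    (hK₁ : ∀ (A : D) (d : ℕ+), d ≠ 1 → ∃ v : (C₁.ratFnFunctor.obj (op A) : Type w),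
      divB C₁.divisorMonoid C₁.ratFnFunctor C₁.divBNatTrans (op A) v = 1 ∧
      ∀ ⦃E : D⦄ (g : E ⟶ A) (t : (C₁.ratFnFunctor.obj (op E) : Type w)),
        (C₁.ratFnFunctor.map g.op).hom v ≠ t ^ (d : ℕ))
    (hK₂ : ∀ (A : D') (d : ℕ+), d ≠ 1 → ∃ v : (C₂.ratFnFunctor.obj (op A) : Type w),
      divB C₂.divisorMonoid C₂.ratFnFunctor C₂.divBNatTrans (op A) v = 1 ∧
      ∀ ⦃E : D'⦄ (g : E ⟶ A) (t : (C₂.ratFnFunctor.obj (op E) : Type w)),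
        (C₂.ratFnFunctor.map g.op).hom v ≠ t ^ (d : ℕ)) :
    h.PreservesPreSteps :=
  ⟨fun _ _ φ hφ => h.isPreStep_map_of_isPreStep_of_unitObstruction hD' hK₂ φ hφ,
    fun _ _ φ hφ => h.isPreStep_inverse_map_of_isPreStep_of_unitObstruction hD hK₁ φ hφ⟩

/-- Point-base instance (every `Discrete`-based toy of the tree): unit obstruction on both sides ⇒ `Ψ` preserves
pre-steps. [cite: MochizukiEtTh2009, Cor 3.8 p.81] -/
theorem preservesPreSteps_of_unitObstruction_of_isDiscrete [IsDiscrete D] [IsDiscrete D']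
    (hK₁ : ∀ (A : D) (d : ℕ+), d ≠ 1 → ∃ v : (C₁.ratFnFunctor.obj (op A) : Type w),
      divB C₁.divisorMonoid C₁.ratFnFunctor C₁.divBNatTrans (op A) v = 1 ∧
      ∀ ⦃E : D⦄ (g : E ⟶ A) (t : (C₁.ratFnFunctor.obj (op E) : Type w)),
        (C₁.ratFnFunctor.map g.op).hom v ≠ t ^ (d : ℕ))
    (hK₂ : ∀ (A : D') (d : ℕ+), d ≠ 1 → ∃ v : (C₂.ratFnFunctor.obj (op A) : Type w),
      divB C₂.divisorMonoid C₂.ratFnFunctor C₂.divBNatTrans (op A) v = 1 ∧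
      ∀ ⦃E : D'⦄ (g : E ⟶ A) (t : (C₂.ratFnFunctor.obj (op E) : Type w)),
        (C₂.ratFnFunctor.map g.op).hom v ≠ t ^ (d : ℕ)) :
    h.PreservesPreSteps :=
  h.preservesPreSteps_of_unitObstruction_of_isIso_of_isFiberwiseSurjective (fun _ _ _ _ => inferInstance)
    (fun _ _ _ _ => inferInstance) hK₁ hK₂

end Cor38Hyp

end Rows

/-! ## Instance: no record with target abc-iut-f-133's `AffDil.C` moves a pre-step -/

namespace AffDil

open Literature.AlgebraicGeometry.Frobenioids.IntAffine

/-- In the admissible base `SingleObj Aff⁺(ℤ)` every fiberwise-surjective arrow is invertible (abc-iut-f-133's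
`IntAffine.not_isFiberwiseSurjective_of_expo_ne_one`: dilations `n ≥ 2` are never fiberwise-surjective).
[cite: MochizukiFrdI2008, §0 p.14] -/
theorem isIso_of_isFiberwiseSurjective {a b : IntAffine.D} (g : a ⟶ b) (hg : IsFiberwiseSurjective g) :
    IsIso g := by
  have he : expo g = 1 := by
    by_contra hne
    exact not_isFiberwiseSurjective_of_expo_ne_one g hne hg
  obtain ⟨U, hU⟩ := (isUnit_iff_expo_eq_one (show IntAffine.G from g)).mpr he
  refine ⟨⟨(↑U⁻¹ : IntAffine.G), ?_, ?_⟩⟩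
  · change (↑U⁻¹ : IntAffine.G) * (show IntAffine.G from g) = 1
    rw [← hU, Units.inv_mul]
  · change (show IntAffine.G from g) * (↑U⁻¹ : IntAffine.G) = 1
    rw [← hU, Units.mul_inv]

/-- **The unit obstruction holds for `AffDil.C`**: the free unit coordinate `k ∈ ℤ` of `B₀^Λ = ℤ × (ℚ_{≥0})^gp`
(acted on trivially by the base) is a pull-back-invariant valuation, and `v = ((1, 0), 0)` is a genuine unit of
valuation `1`. [cite: MochizukiEtTh2009, Def 3.6 p.77] -/
theorem unitObstruction_C (A : IntAffine.D) (d : ℕ+) (hd : d ≠ 1) :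
    ∃ v : (C.ratFnFunctor.obj (op A) : Type),
      divB C.divisorMonoid C.ratFnFunctor C.divBNatTrans (op A) v = 1 ∧
      ∀ ⦃E : IntAffine.D⦄ (g : E ⟶ A) (t : (C.ratFnFunctor.obj (op E) : Type)),
        (C.ratFnFunctor.map g.op).hom v ≠ t ^ (d : ℕ) := by
  refine ⟨⟨((Multiplicative.ofAdd (1 : ℤ), 1), 1), ?_⟩, rfl, ?_⟩
  · change (1 : Algebra.GrothendieckGroup DilSwap.M) = C.ΦgpToRlog (op A) 1
    rw [map_one]
    rfl
  · intro E g t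
    exact ModelFrobenioid.unitObstruction_of_valuation
      (fun A => (MonoidHom.fst _ _).comp ((MonoidHom.fst _ _).comp (C.ratFn A).subtype))
      (fun _ _ _ _ => rfl) _ rfl hd g t

variable {E₀ : Type} [Category.{0} E₀] {T₁ : RealifiedDivisorMonoids (D₀ := E₀) Toy.monoidVocab}
  {D₁ : Type} [Category.{0} D₁] {VD₁ : FrdICatStub.{0, 0, 0} D₁}

/-- **For EVERY typed tempered Frobenioid `C₁` and EVERY record `h : Cor38Hyp C₁ AffDil.C`, `Ψ` carries every
pre-step of `C₁` to a pre-step of `AffDil.C`** — the degree-moving inhabitant of abc-iut-f-133 (where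
`PreservesLinear` FAILS, F-2815) can never be the target of a pre-step-moving record: base half by
abc-iut-w6-d057's fiberwise-surjectivity, degree half by the unit obstruction. [cite: MochizukiEtTh2009, Cor 3.8 p.81] -/
theorem isPreStep_map_of_isPreStep {C₁ : TemperedFrobenioid T₁ D₁ VD₁} (h : Cor38Hyp C₁ C)
    {X Y : C₁.category} (φ : X ⟶ Y) (hφ : C₁.opsData.IsPreStep φ) :
    C.opsData.IsPreStep (h.Ψ.functor.map φ) :=
  h.isPreStep_map_of_isPreStep_of_unitObstruction (fun _ _ g hg => isIso_of_isFiberwiseSurjective g hg)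
    unitObstruction_C φ hφ

/-- The mirror: for EVERY record `h : Cor38Hyp AffDil.C C₂`, `Ψ⁻¹` carries pre-steps of `C₂` to pre-steps of
`AffDil.C`. [cite: MochizukiEtTh2009, Cor 3.8 p.81] -/
theorem isPreStep_inverse_map_of_isPreStep {C₂ : TemperedFrobenioid T₁ D₁ VD₁} (h : Cor38Hyp C C₂)
    {X Y : C₂.category} (φ : X ⟶ Y) (hφ : C₂.opsData.IsPreStep φ) :
    C.opsData.IsPreStep (h.Ψ.inverse.map φ) :=
  h.isPreStep_inverse_map_of_isPreStep_of_unitObstruction (fun _ _ g hg => isIso_of_isFiberwiseSurjective g hg)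
    unitObstruction_C φ hφ

/-- In particular every SELF-record `h : Cor38Hyp AffDil.C AffDil.C` (any self-equivalence `Ψ`, e.g. the
degree↔dilation swap of abc-iut-f-133) preserves pre-steps — abc-iut-w4-d097's `AffDil.preservesPreSteps_hyp` for
ALL records at once. [cite: MochizukiEtTh2009, Cor 3.8 p.81] -/
theorem preservesPreSteps_all (h : Cor38Hyp C C) : h.PreservesPreSteps :=
  h.preservesPreSteps_of_unitObstruction_of_isIso_of_isFiberwiseSurjective
    (fun _ _ g hg => isIso_of_isFiberwiseSurjective g hg) (fun _ _ g hg => isIso_of_isFiberwiseSurjective g hg)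
    unitObstruction_C unitObstruction_C

end AffDil

end Literature.AnabelianGeometry.EtaleTheta
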